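import Mathlib
import Summits.ResolutionOfSingularities.ResolutionOfSingularities.Theorems.WeightedInvariantLocalWeightedDropWildMonicFlagDropAxisPackage

/-!
# `WeightedInvariant.LocalWeightedDrop`, line `hasse-ridge-face-selection`, S3ρ flag line, drop side: Uk-ρD4 — the child-flag type
# N0-SECOND («the flag along the new exceptional curve never wins», Per17 Lemma 9.1.2) from the canonical `n = 0` package

Crux item stmt-ResolutionOfSingularities-8899 `LocalWeightedDrop` (route `ResolutionOfSingularities/WeightedInvariant`), engine of the door
`HypersurfaceCentreConstruction` stmt-ResolutionOfSingularities-19897.  [OURS · L1 W4.3, chain w43; hand res-type-013 on res-L1-w43-plan-1's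
DEALS gen 9 #12 (Uk-ρD4) under the S3ρ owner res-type-083 (CUT 2026-08-27T09:03:29Z): the target `WildMonic.DropAxisN0Second` of
`…WildMonicFlagDropAxisSplit` from res-type-083's `WildMonic.AxisPackageN0` (`…WildMonicFlagDropAxisPackage`; the package itself is
Uk-ρD1's heart, res-D-pv-005 AS stub-7).  MAP: S. Perlega, arXiv:2011.14443 Lemma 9.1.2 (p0104) and Prop 9.1.4 case (1); every object OURS
(stub-3's flag family `flagTriple/IsMMax`, res-type-083's `FirstDominates/IsAxisStep/AxisPackageN0`, `flagTriple_swapT_zero_le`,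
`isMMax_swapT_zero_iff`); not a statement of any manuscript.]

* `firstDominates_of_le` — domination by a first-orientation parent flag passes down along `≤`;
* `flagTriple_swapT_zero_eq` — the triple of the second-orientation `n = 0` flag `(true, g, 0)` of `(C, E′)` is
  `(dRes E′ N′(swap g), 0, sValue (swapE E′) (transposed set))`: its `d` is read on the FIRST reading `(swap g, 0)`;
* **`dropAxisN0Second_of_package : AxisPackageN0 d p k → DropAxisN0Second d p k`** — for a charged axis step with canonical pair
  `(F, F′) = ((g₀,0), (g₀′,0))` and a valid child flag `G = (true, g, 0)`: `g₁ = swap g` is valid with `d_G = d(g₁) ≤ d_{F′} ≤ d_F`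
  (package (iii), (iv)); if `d_G < d_F` the parent flag `F` dominates strictly in the first lexicographic component; if `d_G = d_F`
  (`d` KEPT, `d_G = d_{F′}`) the package's face point (v) makes the second reading minimal on `s` (`flagTriple_swapT_zero_le`), so
  `G ≤ (g₁, 0) ≤ F′` by the `s`-maximality (vii), and `F′ < F` or `s_F = ⊤` by (vi) — `FirstDominates` by `F` in every case.
-/

set_option linter.dupNamespace false -- mandated namespace of this single-conjunct summit

namespace Summit.ResolutionOfSingularities.ResolutionOfSingularities.Theorems

open Literature.AlgebraicGeometry.Resolution
open Literature.AlgebraicGeometry.Resolution.HauserPerlega2024 (Triple)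

namespace WildMonic

open MvPowerSeries MonicDescent
open PurePowerFlag (swap swapE orient orientE IsN0 IsTangent succE)

variable {k : Type} [Field k] {d : ℕ}

/-- Domination by a valid admissible first-orientation parent flag passes down along `≤`. [OURS · Uk-ρD4] -/
theorem firstDominates_of_le {A : Fin d → MvPowerSeries (Fin 2) k} {E : Finset (Fin 2)} {w w' : Triple} (hle : w ≤ w')
    (h : FirstDominates d A E w') : FirstDominates d A E w := by
  obtain ⟨g₀, h₀, hg₀, hh₀, hadm, hmax, hle', hstrict⟩ := h
  refine ⟨g₀, h₀, hg₀, hh₀, hadm, hmax, hle.trans hle', ?_⟩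
  rcases hstrict with hlt | htop
  · exact Or.inl (lt_of_le_of_lt hle hlt)
  · exact Or.inr htop

/-- The `d`-component of the second-orientation `n = 0` flag `(true, g, 0)` is the residual order of the FIRST reading `(swap g, 0)`
(`newtonSet_flagTuple_swapT_zero` + `dRes_swap`). [OURS · Uk-ρD4] -/
theorem flagTriple_swapT_zero_eq (C : Fin d → MvPowerSeries (Fin 2) k) (E' : Finset (Fin 2)) (g : MvPowerSeries (Fin 2) k) :
    flagTriple d (swapT C) (swapE E') g 0 =
      toLex (dRes E' (newtonSet (flagTuple d C (swap g) 0)),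
        toLex (0, sValue d.factorial (swapE E') (newtonSet (flagTuple d (swapT C) g 0)))) := by
  rw [flagTriple_zero_eq, newtonSet_flagTuple_swapT_zero, dRes_swap]

/-- **Uk-ρD4: `DropAxisN0Second` FROM THE CANONICAL `n = 0` PACKAGE** (Per17 Lemma 9.1.2 in game form, res-type-083's CUT 09:03:29Z).
For a charged axis step with package `(g₀, g₀′)` and a VALID second-orientation child flag `G = (true, g, 0)`: its first reading
`g₁ = swap g` is valid (`isMMax_swapT_zero_iff`) with the same `d_G`; `d_G ≤ d_{F′} ≤ d_F` by (iii), (iv).  If `d_G < d_F`, the parent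
flag `F = (g₀, 0)` dominates STRICTLY in the first lexicographic component.  If `d_G = d_F` (so `d` is KEPT and `d_G = d_{F′}`), item (v)
hands a face point `P₀ < d` of `g₁`'s reduced set, so `G ≤ (g₁, 0)` (`flagTriple_swapT_zero_le`: the flag along `D_new` never wins on
`s`), `≤ F′` by the `s`-maximality (vii), and `F′ < F` or `s_F = ⊤` by (vi): `FirstDominates` by `F`. [OURS · Uk-ρD4;
cite: Perlega2020, Lemma 9.1.2 (arXiv:2011.14443 chunk p0104)] -/
theorem dropAxisN0Second_of_package {p : ℕ} (hpkg : AxisPackageN0 d p k) : DropAxisN0Second d p k := by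
  intro A E T φ' hstep g hg hmm
  obtain ⟨hA, hexA, hT, hφ', hposC, hexC⟩ := hstep
  obtain ⟨g₀, g₀', hg₀, hg₀', hmax₀, hmax₀', hdmax, hdle, hface, hsdrop, hsmax⟩ := hpkg A E T φ' ⟨hA, hexA, hT, hφ', hposC, hexC⟩
  -- the first reading `g₁ = swap g` of the child flag
  have hg₁ : constantCoeff (swap g) = 0 := by rw [swap, constantCoeff_rename]; exact hg
  have hmm₁ : IsMMax d (shift d T φ') (succE (0 : k) E) (swap g) 0 := (isMMax_swapT_zero_iff _ _ _).mp hmm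
  -- abbreviations for the numbers
  set dG := dRes (succE (0 : k) E) (newtonSet (flagTuple d (shift d T φ') (swap g) 0)) with hdG
  set sG := sValue d.factorial (swapE (succE (0 : k) E)) (newtonSet (flagTuple d (swapT (shift d T φ')) g 0)) with hsG
  set d' := dRes (succE (0 : k) E) (newtonSet (flagTuple d (shift d T φ') g₀' 0)) with hd'
  set s' := sValue d.factorial (succE (0 : k) E) (newtonSet (flagTuple d (shift d T φ') g₀' 0)) with hs'
  set dP := dRes E (newtonSet (flagTuple d A g₀ 0)) with hdP
  set sP := sValue d.factorial E (newtonSet (flagTuple d A g₀ 0)) with hsP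
  have hvG : flagTriple d (swapT (shift d T φ')) (swapE (succE (0 : k) E)) g 0 = toLex (dG, toLex (0, sG)) :=
    flagTriple_swapT_zero_eq _ _ _
  have hvP : flagTriple d A E g₀ 0 = toLex (dP, toLex (0, sP)) := flagTriple_zero_eq _ _ _
  have hdG_le : dG ≤ dP := (hdmax (swap g) hg₁ hmm₁).trans hdle
  -- the parent dominator is `F = (g₀, 0)` in both cases
  refine ⟨g₀, 0, hg₀, map_zero _, Or.inl (Or.inr rfl : IsN0 E (0 : PowerSeries k)), hmax₀, ?_⟩
  rw [hvG, hvP]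
  rcases hdG_le.lt_or_eq with hlt | heq
  · -- `d` dropped: strict in the first component
    have h : toLex (dG, toLex ((0 : ℕ), sG)) < toLex (dP, toLex ((0 : ℕ), sP)) := Prod.Lex.toLex_lt_toLex.mpr (Or.inl hlt)
    exact ⟨h.le, Or.inl h⟩
  · -- `d` kept: `dG = d' = dP`
    have hkept : d' = dP := le_antisymm hdle (heq ▸ hdmax (swap g) hg₁ hmm₁)
    have hdG' : dG = d' := le_antisymm (hdmax (swap g) hg₁ hmm₁) (hkept.trans heq.symm).le
    -- the face point of `g₁`'s reduced set, hence `G ≤ (g₁, 0)`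
    obtain ⟨P, hP, hP0, hPδ⟩ := hface hkept (swap g) hg₁ hmm₁ hdG'
    have hle₁ : flagTriple d (swapT (shift d T φ')) (swapE (succE (0 : k) E)) g 0 ≤
        flagTriple d (shift d T φ') (succE (0 : k) E) (swap g) 0 :=
      flagTriple_swapT_zero_le (shift d T φ') (succE (0 : k) E) g (newtonSet_flagTuple_zero_nonempty_of_not_exit₃ hexC hg₁)
        (fun Q hQ => factorial_le_of_mem_newtonSet_flagTuple_zero hposC hg₁ hQ) hP hP0 hPδ
    rw [hvG, flagTriple_zero_eq] at hle₁
    -- `s_G ≤ s(g₁) ≤ s'`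
    have hsG_le : sG ≤ s' := by
      have h1 : sG ≤ sValue d.factorial (succE (0 : k) E) (newtonSet (flagTuple d (shift d T φ') (swap g) 0)) := by
        rcases Prod.Lex.toLex_le_toLex.mp hle₁ with h | ⟨-, h⟩
        · exact absurd h (lt_irrefl _)
        · rcases Prod.Lex.toLex_le_toLex.mp h with h' | ⟨-, h'⟩
          · exact absurd h' (lt_irrefl _)
          · exact h'
      exact h1.trans (hsmax (swap g) hg₁ hmm₁ hdG')
    have hdGP : dG = dP := heq
    rcases hsdrop hkept with hslt | hstop
    · have h : toLex (dG, toLex ((0 : ℕ), sG)) < toLex (dP, toLex ((0 : ℕ), sP)) :=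
        Prod.Lex.toLex_lt_toLex.mpr (Or.inr ⟨hdGP, Prod.Lex.toLex_lt_toLex.mpr (Or.inr ⟨rfl, hsG_le.trans_lt hslt⟩)⟩)
      exact ⟨h.le, Or.inl h⟩
    · refine ⟨Prod.Lex.toLex_le_toLex.mpr (Or.inr ⟨hdGP, Prod.Lex.toLex_le_toLex.mpr (Or.inr ⟨rfl, ?_⟩)⟩), Or.inr ?_⟩
      · rw [hstop]; exact le_top
      · exact hstop

end WildMonic

end Summit.ResolutionOfSingularities.ResolutionOfSingularities.Theorems
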